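import Summits.ResolutionOfSingularities.ResolutionOfSingularities.Theorems.HilbertSamuelEliminationSigmaMaxModificationsCorridor3CPFramePropagationLocal
import Summits.ResolutionOfSingularities.ResolutionOfSingularities.Theorems.HilbertSamuelEliminationSigmaMaxModificationsCorridor3CPFramePropagationComplete
import Summits.ResolutionOfSingularities.ResolutionOfSingularities.Theorems.HilbertSamuelEliminationSigmaMaxModificationsCorridor3CPFramePointChart
import Summits.ResolutionOfSingularities.ResolutionOfSingularities.Theorems.HilbertSamuelEliminationSigmaMaxModificationsCorridor3CPFrameChartRegular
import Summits.ResolutionOfSingularities.ResolutionOfSingularities.Theorems.HilbertSamuelEliminationSigmaMaxModificationsCorridor3PsiStable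
import Literature.RingTheory.HilbertSamuel.FlatBaseChange
import Literature.AlgebraicGeometry.Resolution.LogRegularEtaleLocal
import HarnessLib

/-!
# [OURS · L1 W4.2] D18 (i) for POINT centres: a CP frame with `δ ≥ 1` PROPAGATES along a canonical near step whose centre is the closed
# point — `IsCPFrame s R u h φ ∧ (coeff_i h ∈ 𝔪^{m−i}) ⇒ ∃ frame at s'` with the same degree `m` and `δ ≥ 1` again
# (cell res-hironaka, LADDER-RESOLUTION rung L; slot W4.2, crux chain w42 `SigmaMaxModificationsCorridor3` stmt-ResolutionOfSingularities-19249;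
# `--supports stmt-ResolutionOfSingularities-19249 --as helper`; res-L1-w42-plan-1 GO F-74 12:34:43Z «(P2b-glue) scheme glue + HS ⇒ order
# bookkeeping»; hand res-D-brk-3 (gen 6), assembly of the cut G1–G5)

SCHEME-SIDE ASSEMBLY (universe `0`, as `IsCPFrame`/`BirthDictionary3Pt`), 0 `def`s, every declaration PROVED; OURS bookkeeping; NOT a
statement of Hironaka's manuscript [Hironaka2017] nor of [CossartJannsenSaito2020]/[CossartPiltant2019]. AI-written, weaker than expert review.

* **`IsCPFrame.exists_isCPFrame_of_canonicalNearStep_of_stalkIdeal_eq`** — along a chain of canonical near steps from a maximal origin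
  (functional admissible oracle, so that res-type-064's `hilbertFun_stalk_eq_of_canonicalNearStep` / `ringKrullDim_stalk_eq_of_canonicalNearStep`
  give `H_{x_{n+1}} = H_{x_n}` and `dim 𝒪_{x_{n+1}} = dim 𝒪_{x_n}`), at a step `s → s'` whose canonical centre `C` has stalk ideal `𝔪_{x_n}`
  at `x_n` (POINT centre), every CP frame `(R, u, h, φ)` of `s` whose lower coefficients satisfy `coeff_i h ∈ 𝔪_R^{m−i}` (`δ(h;u) ≥ 1`,
  CP 2019 Prop. 2.3 with `θ ∈ 𝔪`) yields a CP frame `(R', u', h', φ')` of `s'` with `deg h' = deg h` and `coeff_i h' ∈ 𝔪_{R'}^{m−i}`, over a COMPLETE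
  base `R'` (`IsAdicComplete (maximalIdeal R') R'`, kept for re-preparation at the next centre).
  Chain: G2 `IsCPFrame.exists_chart_presentation` (𝒪_{x'} → a chart algebra of `B = R[X]/(h)` blown up in `𝔪_B`, flat glue G1) →
  G5 (ii-b) `exists_adjoinRoot_chart_presentation` (monic transform `h'` over `S = R[𝔪/u_{j₀}]`) → G5 (ii-a) `S_𝔮` regular →
  G5 (ii-c) `exists_local_frame_of_chart_presentation` (near ⇒ order `m` persists, CJS Thm. 2.3 numerically; near shape; `S_𝔮[X]/(h')`
  local; translate with `δ ≥ 1`) → G5 (ii-d) `exists_complete_minimal_frame` (completion, Hironaka's vertex preparation = res-lit-4).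
  What is NOT here: curve/surface centres (need the frame ADAPTED to the centre, `IsCPFrameAlong`, and equimultiplicity along `C`), and the
  bare `IsHypStage s → IsHypStage s'` (the invariant propagated is `IsCPFrame ∧ δ ≥ 1`, see the TAKING note of 13:03:41Z).

References: CJS LNM 2270 Thm. 2.3, §2.2, Lemma 2.27 [CossartJannsenSaito2020]; CP 2019 Prop. 2.2–2.6, (2.7) [CossartPiltant2019];
Hironaka 1967 [Hironaka1967]; Matsumura Thms. 8.14, 15.1, 19.5, 23.7 [Matsumura1987]; tree G1–G5 of this cut, 050/064/067's files.
-/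

noncomputable section

set_option linter.dupNamespace false

open CategoryTheory AlgebraicGeometry TopologicalSpace IsLocalRing Polynomial
open Literature.AlgebraicGeometry.Resolution Literature.RingTheory.HilbertSamuel
open Summit.ResolutionOfSingularities.ResolutionOfSingularities.Theorems.CampaignW42
open Summit.ResolutionOfSingularities.ResolutionOfSingularities.Theorems.SigmaMaxModificationsCorridor3.Helpers

namespace Summit.ResolutionOfSingularities.ResolutionOfSingularities.Theorems.SigmaMaxModificationsCorridor3.Moving

/-- A CP frame polynomial has positive degree (`R[X]/(h)` is local, hence nontrivial). [folklore] -/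
theorem IsCPFrame.natDegree_pos {s : MarkedStage.{0}} {R : Type} [CommRing R] {u : Fin 3 → R} {h : R[X]}
    {φ : (s.W.presheaf.stalk s.pt : Type) →+* R[X] ⧸ Ideal.span {h}} (hF : IsCPFrame s R u h φ) : 0 < h.natDegree := by
  obtain ⟨_, hloc, _, _, hmon, _⟩ := hF
  by_contra h0
  have h1 : h = 1 := Polynomial.eq_one_of_monic_natDegree_zero hmon (Nat.eq_zero_of_not_pos h0)
  have h2 : Ideal.span {h} = ⊤ := by rw [h1, Ideal.span_singleton_one]
  haveI : Subsingleton (R[X] ⧸ Ideal.span {h}) := Ideal.Quotient.subsingleton_iff.mpr h2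
  exact not_nontrivial (R[X] ⧸ Ideal.span {h}) inferInstance

/-- [OURS · L1 W4.2] **D18 (i), point centres: CP frames with `δ ≥ 1` propagate along a canonical near step blowing up the closed point.**
See the module docstring. [cite: CossartJannsenSaito2020, Thm. 2.3 and §2.2] [cite: CossartPiltant2019, Prop. 2.2–2.6, (2.7) (arXiv v1 pp. 11–14)] -/
theorem IsCPFrame.exists_isCPFrame_of_canonicalNearStep_of_stalkIdeal_eq {p : ℕ} {R₀ : ∀ S : Scheme.{0}, CentreSeq S → Prop}
    (hRf : OracleFunctional R₀) (hRa : OracleAdmissible R₀) {ν : ℕ → ℕ} {X₀ : Scheme.{0}} [IsLocallyNoetherian X₀] {x : X₀}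
    (hX : IsMaximalOrigin p 3 ν X₀ x) {s s' : MarkedStage.{0}} (hs : Reaches R₀ 3 ν (MarkedStage.init X₀ x) s)
    (hstep : CanonicalNearStep R₀ 3 ν s s')
    (hpt : ∀ (C : s.W.IdealSheafData) (P' : Option (Pending (blowup C))), IsCanonicalStep R₀ 3 ν s.L s.P C P' →
      stalkIdeal C s.pt = maximalIdeal (s.W.presheaf.stalk s.pt))
    {R : Type} [CommRing R] [IsLocalRing R] {u : Fin 3 → R} {h : R[X]}
    {φ : (s.W.presheaf.stalk s.pt : Type) →+* R[X] ⧸ Ideal.span {h}} (hF : IsCPFrame s R u h φ)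
    (hco : ∀ i < h.natDegree, h.coeff i ∈ maximalIdeal R ^ (h.natDegree - i)) :
    ∃ (R' : Type) (_ : CommRing R') (_ : IsLocalRing R') (u' : Fin 3 → R') (h' : R'[X])
      (φ' : (s'.W.presheaf.stalk s'.pt : Type) →+* R'[X] ⧸ Ideal.span {h'}),
      IsCPFrame s' R' u' h' φ' ∧ IsAdicComplete (maximalIdeal R') R' ∧ h'.natDegree = h.natDegree ∧
      ∀ i < h'.natDegree, h'.coeff i ∈ maximalIdeal R' ^ (h'.natDegree - i) := by
  have hm : 0 < h.natDegree := hF.natDegree_pos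
  have hH := hilbertFun_stalk_eq_of_canonicalNearStep hRf hRa hX hs hstep
  have hd := ringKrullDim_stalk_eq_of_canonicalNearStep hRf hRa hX hs hstep
  obtain ⟨C, P', hln', x', hcs, hx', hcl, hstr, rfl⟩ := hstep
  have hF' := hF
  obtain ⟨hR, hloc, hdim, hu, hmon, hφl, hflat, hmap, hsurj, hmin⟩ := hF'
  haveI := hR
  haveI := hloc
  haveI : IsLocalRing (AdjoinRoot h) := hloc
  haveI : IsLocallyNoetherian s.W := s.ln
  haveI : IsLocallyNoetherian (blowup C) := hln'
  have hdim3 : ringKrullDim R = ((3 : ℕ) : WithBot ℕ∞) := hdim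
  -- G2: the presentation of `𝒪_{x'}` on a chart algebra of `B = R[X]/(h)`
  obtain ⟨k, c, j, 𝔔', h𝔔'p, ψ', hc, h1, h2, h3, h4, h5, _⟩ := hF.exists_chart_presentation C x' hx'
  haveI := h𝔔'p
  -- the centre is the closed point: `C_{x_n} B = 𝔪_B = ((u) + (X))/(h)`
  have hJm : (stalkIdeal C s.pt).map φ = maximalIdeal (R[X] ⧸ Ideal.span {h}) := by rw [hpt C P' hcs, hmap]
  have hJ : (stalkIdeal C s.pt).map φ =
      ((Ideal.span (Set.range u)).map (Polynomial.C : R →+* R[X]) ⊔ Ideal.span {X}).map (Ideal.Quotient.mk (Ideal.span {h})) :=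
    hJm.trans (maximalIdeal_quotient_eq_frameIdeal hu hmon hm (fun i hi => Ideal.pow_le_self (by omega) (hco i hi)))
  have hg : φ (c j) ∈ (stalkIdeal C s.pt).map φ := Ideal.mem_map_of_mem φ (hc ▸ Ideal.subset_span ⟨j, rfl⟩)
  -- G5 (ii-b): the monic transform over `S = R[𝔪/u_{j₀}]`
  obtain ⟨j₀, h', 𝔔₃, h𝔔₃p, ψ₃, hmon', hdeg', -, h𝔮, hflat₃, hloc₃, hmap₃, hres₃⟩ :=
    exists_adjoinRoot_chart_presentation hdim3 u hu hmon hm hco ((stalkIdeal C s.pt).map φ) hJ hg 𝔔' (h1.trans hJm.symm)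
      ψ' h2 h3 h4 h5
  haveI := h𝔔₃p
  -- G5 (ii-a): the new base `S_𝔮` is regular; `S` is a Noetherian domain
  haveI : ((𝔔₃.comap (AdjoinRoot.mk h')).comap Polynomial.C).IsPrime := Ideal.comap_isPrime _ _
  haveI : IsDomain R := isDomain_of_isRegularLocalRing R
  have hrsop : IsRsopPart u := isRsopPart_of_span_range_eq_maximalIdeal hdim3 u hu
  have hprime := prime_algebraMap_blowupAlgebra_of_isRsopPart hrsop j₀
  have hu0 : u j₀ ≠ 0 := fun h0 => hprime.ne_zero (by rw [h0, map_zero])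
  haveI : IsDomain (Localization.Away (u j₀)) :=
    IsLocalization.isDomain_localization (powers_le_nonZeroDivisors_of_noZeroDivisors hu0)
  haveI : IsDomain (blowupAlgebra (Ideal.span (Set.range u)) (u j₀)) := Subalgebra.isDomain _
  haveI : IsNoetherianRing (blowupAlgebra (Ideal.span (Set.range u)) (u j₀)) :=
    isNoetherianRing_blowupAlgebra_of_isNoetherianRing _ _
  have hreg : IsRegularLocalRing (Localization.AtPrime ((𝔔₃.comap (AdjoinRoot.mk h')).comap Polynomial.C)) :=
    isRegularLocalRing_localization_blowupAlgebra_of_comap_eq hdim3 u hu j₀ _ h𝔮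
  -- nearness in Hilbert–Samuel form, read on `B`
  letI algφ : Algebra (s.W.presheaf.stalk s.pt : Type) (R[X] ⧸ Ideal.span {h}) := φ.toAlgebra
  haveI : Module.Flat (s.W.presheaf.stalk s.pt : Type) (R[X] ⧸ Ideal.span {h}) := hflat
  haveI : IsLocalHom (algebraMap (s.W.presheaf.stalk s.pt : Type) (R[X] ⧸ Ideal.span {h})) := hφl
  have hHB : hilbertFun (R[X] ⧸ Ideal.span {h}) = hilbertFun (s.W.presheaf.stalk s.pt : Type) :=
    hilbertFun_eq_of_flat_of_map_maximalIdeal_eq (A := (s.W.presheaf.stalk s.pt : Type)) (B := R[X] ⧸ Ideal.span {h}) hmap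
  have hdB : ringKrullDim (R[X] ⧸ Ideal.span {h}) = ringKrullDim (s.W.presheaf.stalk s.pt : Type) :=
    Literature.AlgebraicGeometry.Resolution.ringKrullDim_eq_of_flat_of_map_maximalIdeal_eq (s.W.presheaf.stalk s.pt : Type)
      (R[X] ⧸ Ideal.span {h}) hmap
  have hHO : hilbertFun ((blowup C).presheaf.stalk x' : Type) = hilbertFun (AdjoinRoot h) := hH.trans hHB.symm
  have hdO : ringKrullDim ((blowup C).presheaf.stalk x' : Type) = ringKrullDim (AdjoinRoot h) := hd.trans hdB.symm
  -- G5 (ii-c): the frame over `S_𝔮`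
  obtain ⟨θ', hloc₁, φ₁, hdimS, hmo₁, hdeg₁, hco₁, hf₁, hl₁, hm₁, hr₁⟩ :=
    exists_local_frame_of_chart_presentation hmon hm hco _ hreg hmon' hdeg' 𝔔₃ rfl ψ₃ hflat₃ hloc₃ hmap₃ hres₃ hHO hdO
  haveI := hloc₁
  -- G5 (ii-d): completion and vertex preparation
  have hm₁' : 0 < ((h'.map (algebraMap _ (Localization.AtPrime ((𝔔₃.comap (AdjoinRoot.mk h')).comap Polynomial.C)))).comp
      (X + Polynomial.C θ')).natDegree := by
    rw [hdeg₁]; exact hm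
  obtain ⟨R', _, hreg', u', h₂, hloc₂, φ₂, hcpl, hdim', hu', hmon₂, hdeg₂, hco₂, hl₂, hf₂, hm₂, hr₂, hmin₂⟩ :=
    exists_complete_minimal_frame (hdimS.trans hdim3) hmo₁ hm₁' (fun i hi => by
      rw [hdeg₁] at hi ⊢; exact hco₁ i hi) φ₁ hl₁ hf₁ hm₁ hr₁
  haveI := hreg'
  exact ⟨R', inferInstance, inferInstance, u', h₂, φ₂, ⟨hreg', hloc₂, hdim', hu', hmon₂, hl₂, hf₂, hm₂, hr₂, hmin₂⟩,
    hcpl, hdeg₂.trans hdeg₁, hco₂⟩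

end Summit.ResolutionOfSingularities.ResolutionOfSingularities.Theorems.SigmaMaxModificationsCorridor3.Moving

end
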